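import Literature.Analysis.Complex.LoewnerFastTrackJensen
import Mathlib

/-!
# Proof of `TraceCauchySchwarz` (card `axial-mirror-moments`, crux stmt-QuantumFields-9442)

Hilbert–Schmidt Cauchy–Schwarz for ring traces with a positive semidefinite transfer matrix:
`‖Tr(T^m F T^n G)‖ ≤ √(re Tr(T^m F T^n Fᴴ) · re Tr(T^m Gᴴ T^n G))`.
Statement copied verbatim from `Sketch.lean`; proof via one Hermitian square root `P` of `T^m`
(continuous functional calculus, tree lemma `Literature.Analysis.Complex.cfc_sqrt_mul_self`) and
Cauchy–Schwarz in Mathlib's semi-inner-product space `⟪x, y⟫ = Tr(y T^n xᴴ)`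
(`Matrix.toMatrixInnerProductSpace`).
-/

noncomputable section

namespace Summit.QuantumFields.YangMills.Cruxes.FiniteSusceptibilityWeakCoupling.Sketch

open scoped ComplexOrder Matrix InnerProductSpace
open Matrix

/-- Verbatim copy of the statement in `Sketch.lean`. -/
def TraceCauchySchwarz : Prop :=
  ∀ (k : ℕ) (T F G : Matrix (Fin k) (Fin k) ℂ), T.PosSemidef → ∀ m n : ℕ,
    ‖(T ^ m * F * T ^ n * G).trace‖ ≤
      Real.sqrt ((T ^ m * F * T ^ n * Fᴴ).trace.re * (T ^ m * Gᴴ * T ^ n * G).trace.re)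

section Sqrt
open scoped MatrixOrder Matrix.Norms.L2Operator

/-- A Hermitian square root of `T ^ m` for positive semidefinite `T`. [folklore] -/
theorem exists_hermitian_sqrt_pow {k : ℕ} {T : Matrix (Fin k) (Fin k) ℂ} (hT : T.PosSemidef)
    (m : ℕ) : ∃ P : Matrix (Fin k) (Fin k) ℂ, P.IsHermitian ∧ P * P = T ^ m := by
  classical
  refine ⟨cfc Real.sqrt (T ^ m), ?_, ?_⟩
  · exact (cfc_predicate Real.sqrt (T ^ m) : IsSelfAdjoint _)
  · exact Literature.Analysis.Complex.cfc_sqrt_mul_self (hT.pow m)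

end Sqrt

section CS

/-- Cauchy–Schwarz for the semi-inner product `⟪x, y⟫ = Tr(y M xᴴ)`, `M ≥ 0`. [folklore] -/
theorem norm_trace_mul_mul_conjTranspose_le {k : ℕ} {M : Matrix (Fin k) (Fin k) ℂ}
    (hM : M.PosSemidef) (x y : Matrix (Fin k) (Fin k) ℂ) :
    ‖(y * M * xᴴ).trace‖ ≤ Real.sqrt ((y * M * yᴴ).trace.re * (x * M * xᴴ).trace.re) := by
  letI : SeminormedAddCommGroup (Matrix (Fin k) (Fin k) ℂ) := M.toMatrixSeminormedAddCommGroup hM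
  letI : InnerProductSpace ℂ (Matrix (Fin k) (Fin k) ℂ) := M.toMatrixInnerProductSpace hM
  have h1 : ⟪x, y⟫_ℂ = (y * M * xᴴ).trace := rfl
  have hx : ‖x‖ ^ 2 = (x * M * xᴴ).trace.re := by
    rw [@norm_sq_eq_re_inner ℂ]; rfl
  have hy : ‖y‖ ^ 2 = (y * M * yᴴ).trace.re := by
    rw [@norm_sq_eq_re_inner ℂ]; rfl
  calc ‖(y * M * xᴴ).trace‖ = ‖⟪x, y⟫_ℂ‖ := by rw [h1]
    _ ≤ ‖x‖ * ‖y‖ := norm_inner_le_norm x y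
    _ = ‖y‖ * ‖x‖ := mul_comm _ _
    _ = Real.sqrt ((‖y‖ * ‖x‖) ^ 2) :=
        (Real.sqrt_sq (mul_nonneg (norm_nonneg _) (norm_nonneg _))).symm
    _ = Real.sqrt ((y * M * yᴴ).trace.re * (x * M * xᴴ).trace.re) := by
        rw [mul_pow, hx, hy]

end CS

/-- Conjugating by a square root `P` of `T^m` inside a trace. [folklore] -/
theorem trace_sqrt_conj {k : ℕ} {T P : Matrix (Fin k) (Fin k) ℂ} {m : ℕ} (hPP : P * P = T ^ m)
    (n : ℕ) (X Z : Matrix (Fin k) (Fin k) ℂ) :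
    (P * X * T ^ n * (Z * P)).trace = (T ^ m * X * T ^ n * Z).trace := by
  calc (P * X * T ^ n * (Z * P)).trace = ((P * (X * T ^ n * Z)) * P).trace := by
        simp only [Matrix.mul_assoc]
    _ = (P * (P * (X * T ^ n * Z))).trace := Matrix.trace_mul_comm _ _
    _ = (T ^ m * X * T ^ n * Z).trace := by
        rw [← Matrix.mul_assoc, hPP]; simp only [Matrix.mul_assoc]

/-- **`TraceCauchySchwarz` holds.** [folklore] -/
theorem traceCauchySchwarz_holds : TraceCauchySchwarz := by
  intro k T F G hT m n
  obtain ⟨P, hPh, hPP⟩ := exists_hermitian_sqrt_pow hT m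
  have hTn : (T ^ n).PosSemidef := hT.pow n
  have key := norm_trace_mul_mul_conjTranspose_le hTn (P * Gᴴ) (P * F)
  have c1 : (P * Gᴴ)ᴴ = G * P := by
    rw [conjTranspose_mul, conjTranspose_conjTranspose, hPh.eq]
  have c2 : (P * F)ᴴ = Fᴴ * P := by
    rw [conjTranspose_mul, hPh.eq]
  rw [c1, c2, trace_sqrt_conj hPP n F G, trace_sqrt_conj hPP n F Fᴴ,
    trace_sqrt_conj hPP n Gᴴ G] at key
  exact key

end Summit.QuantumFields.YangMills.Cruxes.FiniteSusceptibilityWeakCoupling.Sketch
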